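import Literature.MathematicalPhysics.QuantumLattice.DWaveSourceWindowCertificateD4
import Literature.MathematicalPhysics.QuantumLattice.HubbardNNNHoppingCorrelatorCertificate
import HarnessLib

/-!
# The `d`-wave pair-sourced `t–t'` Hubbard torus (pinning field) and certificates for the
# orbit-averaged expectations of ITS eigenvectors

Topic `MathematicalPhysics/QuantumLattice`, family `hubbard`. Companion of `DWaveSource.lean`
(`dWaveSourceTorus L U μ h = H_L(1,U) − μN − h(Δ_d + Δ_d†)`, Koma–Tasaki 1994 §1, nearest-neighbour
hopping only) and of `HubbardNNNHoppingCorrelatorCertificate.lean` (local certificates with an energy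
constraint read in the space-group-averaged vector state of an eigenvector of the PARTICLE-NUMBER
CONSERVING `t–t'` torus, Wang et al. 2024 §III / Han 2020 §3).

* `dWaveSourceTorusTT' L tp U μ h = hubbardTorusTT' L 1 tp U − μ N − h (Δ_d + Δ_d†)` — the
  grand-canonical `t–t'` Hubbard Hamiltonian of Xu et al. (2024, eq. (1)) with the `d_{x²−y²}`
  PAIR SOURCE ("pinning field") of Koma–Tasaki (1994, §1); at `tp = 0` it is `dWaveSourceTorus`
  (`dWaveSourceTorusTT'_zero_tp`). It is Hermitian, conserves `S^z` (the singlet source carries no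
  `S^z`) and fermion parity but NOT the particle number, and commutes with the torus translations and
  with the affine `D₄` maps in the kernel of `χ_{B₁g}` (identity, rotation by `π`, the two axis
  reflections; the quarter turn maps `h ↦ −h`).
* `fockSpinZSector M` — the `S^z = M` eigenspace of the Fock space (ALL particle numbers): the
  sector in which eigenvectors of the sourced Hamiltonian are taken (`szSector N M ≤ fockSpinZSector M`).
* `dWaveSourceTorusTT'_re_orbitState_ge_of_local_certificate_ineq` — the SOURCED twin of
  `hubbardTorusTT'_re_orbitState_ge_of_local_certificate_ineq`: a torus identity
  `X − c·1 − Σᵢ μᵢ (Dᵢ − νᵢ·1) − κ (u·1 − E_loc) = SOS + Σ[A, Xₖ] + Σ(U Y Uᴴ − Y) + Σ(Z(Q−q) + (Q−q)Z')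
   + Σ(C W − W C) + Σ d(Vᴴ − V) + Σ a M`, with the translates of `E_loc` summing to
  `A = dWaveSourceTorusTT' L tp U μ h`, symmetry unitaries `U_w D_γ` with `χ_{B₁g}(γ) = 1`, charges
  acting as real scalars on `fockSpinZSector M` (e.g. `S^z`; NOT `N`), proves
  `c − Σ‖aₖ‖ + Σᵢ μᵢ (gᵢ/L² − νᵢ) + κ (u − E/L²) ≤ Re ω̄_ψ(X)` for EVERY unit eigenvector
  `A ψ = E ψ` with `S^z ψ = M ψ`, `ω̄_ψ` the orbit state over `(U_w D_γ)_{w, γ ∈ S}`; and the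
  `κ ≥ 0`, `E/L² ≤ u` corollary `…_of_energy_le`. This is the finite-torus soundness edge of a
  PINNING-FIELD observable table (certified windows on `ω̄_ψ(Φ₀ + Φ₀†)`, pair words, densities of the
  sourced ground states GIVEN an energy ceiling at field `h`).

HONEST SCOPE. Nothing here bears on `d`-wave order of the Hubbard model: a response AT FIXED `h > 0`
is symmetry-allowed and says nothing about `h → 0` after `L → ∞` (barrier
`SourcedOrderWithoutGroundStateLRO` is not crossed). The window (thermodynamic-limit bootstrap) form —
pull-back of a window identity along `x ↦ x mod L` — is NOT in this file. Everything is PROVED; the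
only definitions are the Hamiltonian and the `S^z` eigenspace; no named fact.

## References
* T. Koma, H. Tasaki, J. Stat. Phys. 76 (1994) 745–803, §1 (symmetry-breaking source `H − hO`).
  [cite: KomaTasaki1994, §1]
* H. Xu et al., Science 384 (2024) eadh7691, eq. (1) (the `t–t'` Hubbard Hamiltonian; pairing
  pinning fields in the DMRG). [cite: XuEtAl2024, eq. (1)]
* J. Wang et al., Phys. Rev. X 14 (2024) 031006, §III (energy constraint in relaxations of `⟨O⟩`).
  [cite: WangEtAl2024, §III]
* X. Han, arXiv:2006.06002 (2020), §3 (translation / point-group / charge constraints).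
  [cite: Han2020Bootstrap, §3]
* D. J. Scalapino, Phys. Rep. 250 (1995) 329, §2 (`B₁g` channel of `C₄ᵥ ≅ D₄`). [cite: Scalapino1995, §2]
-/

noncomputable section

namespace Literature.MathematicalPhysics.QuantumLattice

open Matrix Finset HubbardWave0 Literature.Probability.LatticeModels
open Literature.MathematicalPhysics.QuantumManyBody.StateRelaxation
open scoped ComplexOrder BigOperators

/-! ### The `S^z` eigenspaces of the Fock space -/

section SpinZ

variable {Λ : Type*} [LinearOrder Λ] [Fintype Λ]

/-- The `S^z = M` eigenspace of the fermionic Fock space over the orbitals `Λ × {↑,↓}` — ALL particle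
numbers (the pair source breaks `U(1)` down to fermion parity, so eigenvectors of the sourced
Hamiltonian are labelled by `S^z` alone). `szSector N M = nParticleSubmodule N ⊓ fockSpinZSector M`.
[cite: KomaTasaki1994, §1] -/
def fockSpinZSector (M : ℝ) : Submodule ℂ (Fock (Orb Λ)) :=
  Module.End.eigenspace (Matrix.toLin' (spinZ : Matrix (Finset (Orb Λ)) _ ℂ)) (M : ℂ)

/-- Membership in the `S^z` eigenspace, unfolded: `ψ ∈ fockSpinZSector M ↔ S^z ψ = M ψ` (the conserved
charge `S^z` of the square-lattice bootstrap, Han 2020 §3). [cite: Han2020Bootstrap, §3] -/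
theorem mem_fockSpinZSector_iff (M : ℝ) (ψ : Fock (Orb Λ)) :
    ψ ∈ fockSpinZSector M ↔ spinZ *ᵥ ψ = (M : ℂ) • ψ := by
  simp [fockSpinZSector]

/-- The joint sector `(N, S^z = M)` lies in the `S^z = M` eigenspace. [cite: Han2020Bootstrap, §3] -/
theorem szSector_le_fockSpinZSector (N : ℕ) (M : ℝ) :
    (szSector N M : Submodule ℂ (Fock (Orb Λ))) ≤ fockSpinZSector M := fun ψ hψ =>
  (mem_fockSpinZSector_iff M ψ).2 ((mem_szSector_iff N M ψ).1 hψ).2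

/-- `S^z` acts as the real scalar `M` on `fockSpinZSector M` (charge constraint of Han 2020 §3).
[cite: Han2020Bootstrap, §3] -/
theorem spinZ_mulVec_of_mem_fockSpinZSector {M : ℝ} {ψ : Fock (Orb Λ)} (hψ : ψ ∈ fockSpinZSector M) :
    spinZ *ᵥ ψ = ((M : ℝ) : ℂ) • ψ :=
  (mem_fockSpinZSector_iff M ψ).1 hψ

/-- Orbital relabellings induced by site permutations preserve the `S^z` eigenspaces
(`U_g` commutes with `S^z`; symmetry and charge constraints are compatible, Han 2020 §3).
[cite: Han2020Bootstrap, §3] -/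
theorem fockRelabel_mapEquiv_mulVec_mem_fockSpinZSector (g : Equiv.Perm Λ) {M : ℝ} {ψ : Fock (Orb Λ)}
    (hψ : ψ ∈ fockSpinZSector M) : (fockRelabel (Orb.mapEquiv g)).val *ᵥ ψ ∈ fockSpinZSector M := by
  rw [mem_fockSpinZSector_iff] at hψ ⊢
  rw [mulVec_mulVec, ← (fockRelabel_mapEquiv_commute_spinZ g).eq, ← mulVec_mulVec, hψ, mulVec_smul]

end SpinZ

/-! ### The pair-sourced `t–t'` torus Hamiltonian -/

section Torus

variable (L : ℕ) [NeZero L]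

/-- **The `d`-wave pair-sourced grand-canonical `t–t'` Hubbard Hamiltonian on the torus `(ℤ/Lℤ)²`**
(hopping `t = 1`, diagonal hopping `tp`, repulsion `U`, chemical potential `μ`, pinning field `h`):
`A_L = hubbardTorusTT' L 1 tp U − μ N − h (Δ_d + Δ_d†)`, `Δ_d = pairField dWaveFormFactor L`.
Xu et al. (2024) eq. (1) with the Koma–Tasaki symmetry-breaking source (1994, §1).
[cite: KomaTasaki1994, §1] -/
def dWaveSourceTorusTT' (tp U μ h : ℝ) :
    Matrix (Finset (Orb (FermionTorus 2 L))) (Finset (Orb (FermionTorus 2 L))) ℂ :=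
  hubbardTorusTT' L 1 tp U - (μ : ℂ) • totalNumber -
    (h : ℂ) • (pairField dWaveFormFactor L + (pairField dWaveFormFactor L)ᴴ)

/-- At `tp = 0` the sourced `t–t'` torus is the tree's `dWaveSourceTorus`. [cite: KomaTasaki1994, §1] -/
@[simp] theorem dWaveSourceTorusTT'_zero_tp (U μ h : ℝ) :
    dWaveSourceTorusTT' L 0 U μ h = dWaveSourceTorus L U μ h := by
  rw [dWaveSourceTorusTT', hubbardTorusTT'_zero, dWaveSourceTorus, hubbardTorusWith_eq]

/-- The sourced `t–t'` torus is the sourced torus plus the diagonal hopping term: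
`A^{tp}_L = dWaveSourceTorus L U μ h + hamiltonian (diagonal graph) tp 0`. [cite: XuEtAl2024, eq. (1)] -/
theorem dWaveSourceTorusTT'_eq_dWaveSourceTorus_add (tp U μ h : ℝ) :
    dWaveSourceTorusTT' L tp U μ h =
      dWaveSourceTorus L U μ h + hamiltonian (fermionTorusDiagGraph L) tp 0 := by
  rw [dWaveSourceTorusTT', hubbardTorusTT', dWaveSourceTorus, hubbardTorusWith_eq, hubbardTorus]
  abel

/-- Without source the Hamiltonian is the grand-canonical `t–t'` Hamiltonian `H^{tt'} − μN`.
[cite: XuEtAl2024, eq. (1)] -/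
theorem dWaveSourceTorusTT'_zero_source (tp U μ : ℝ) :
    dWaveSourceTorusTT' L tp U μ 0 = hubbardTorusTT' L 1 tp U - (μ : ℂ) • totalNumber := by
  simp [dWaveSourceTorusTT']

/-- The sourced `t–t'` torus Hamiltonian is Hermitian. [cite: KomaTasaki1994, §1] -/
theorem dWaveSourceTorusTT'_isHermitian (tp U μ h : ℝ) : (dWaveSourceTorusTT' L tp U μ h).IsHermitian := by
  unfold dWaveSourceTorusTT'
  refine ((hubbardTorusTT'_isHermitian L 1 tp U).sub (IsHermitian.smul totalNumber_isHermitian ?_)).sub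
    (IsHermitian.smul (isHermitian_pairField_add_conjTranspose L) ?_)
  · rw [isSelfAdjoint_iff, Complex.star_def, Complex.conj_ofReal]
  · rw [isSelfAdjoint_iff, Complex.star_def, Complex.conj_ofReal]

/-- **`S^z` is conserved**: `S^z A_L = A_L S^z` (the singlet pair source carries no `S^z`).
[cite: KomaTasaki1994, §1] -/
theorem spinZ_mul_dWaveSourceTorusTT' (tp U μ h : ℝ) :
    HubbardWave0.spinZ * dWaveSourceTorusTT' L tp U μ h = dWaveSourceTorusTT' L tp U μ h * HubbardWave0.spinZ := by
  have hdiag : Commute HubbardWave0.spinZ (hamiltonian (fermionTorusDiagGraph L) tp 0) :=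
    ((hamiltonian_isHermitian_and_commute_holds (fermionTorusDiagGraph L) tp 0).2.2).symm
  have h0 : Commute HubbardWave0.spinZ (dWaveSourceTorus L U μ h) := spinZ_mul_dWaveSourceTorus L U μ h
  rw [dWaveSourceTorusTT'_eq_dWaveSourceTorus_add]
  exact (h0.add_right hdiag).eq

/-- **Translation invariance**: `U_v A_L = A_L U_v`. [cite: KomaTasaki1994, §1] -/
theorem fockTranslate_mul_dWaveSourceTorusTT' (v : TorusSite 2 L) (tp U μ h : ℝ) :
    (fockTranslate v).val * dWaveSourceTorusTT' L tp U μ h =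
      dWaveSourceTorusTT' L tp U μ h * (fockTranslate v).val := by
  refine (fockRelabel_commute_of_relabel_eq _ ?_).eq
  rw [dWaveSourceTorusTT', relabel_sub, relabel_sub, relabel_smul, relabel_smul, relabel_add,
    relabel_conjTranspose, relabel_translate_hubbardTorusTT', relabel_translate_pairField, Orb.translate,
    relabel_mapEquiv_totalNumber]

/-- **The affine `D₄` maps in the kernel of `χ_{B₁g}` commute with the sourced `t–t'` torus**: for
`χ_{B₁g}(γ) = 1` and every torus vector `w`, `U_w D_γ A_L = A_L U_w D_γ` (`D_γ Δ_d D_γᴴ = χ_{B₁g}(γ) Δ_d`).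
[cite: Scalapino1995, §2] -/
theorem d4Affine_mul_dWaveSourceTorusTT' (γ : DihedralGroup 4) (hγ : b1gChar γ = 1) (w : TorusSite 2 L)
    (tp U μ h : ℝ) :
    (fockTranslate w).val * (fockD4 (L := L) γ).val * dWaveSourceTorusTT' L tp U μ h =
      dWaveSourceTorusTT' L tp U μ h * ((fockTranslate w).val * (fockD4 (L := L) γ).val) := by
  have hD : (fockD4 (L := L) γ).val * dWaveSourceTorusTT' L tp U μ h =
      dWaveSourceTorusTT' L tp U μ h * (fockD4 (L := L) γ).val := by
    refine (fockRelabel_commute_of_relabel_eq _ ?_).eq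
    rw [dWaveSourceTorusTT', relabel_sub, relabel_sub, relabel_smul, relabel_smul, relabel_add,
      relabel_conjTranspose, relabel_d4Perm_hubbardTorusTT', relabel_d4Perm_pairField_dWave, hγ, one_smul,
      Orb.d4Perm_eq_mapEquiv, relabel_mapEquiv_totalNumber]
  rw [Matrix.mul_assoc, hD, ← Matrix.mul_assoc, fockTranslate_mul_dWaveSourceTorusTT', Matrix.mul_assoc]

end Torus

/-! ### The torus theorem: a local certificate read in the orbit state of an eigenvector of the
sourced Hamiltonian -/

section Certificate

variable {L : ℕ} [NeZero L]

/-- (Local to this section, as in `HubbardNNNHoppingCorrelatorCertificate`.) [folklore] -/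
local instance (priority := high) instDecidableEqFermionTorusSrcTT : DecidableEq (FermionTorus 2 L) :=
  LinearOrder.toDecidableEq

/-- `U_w D_γ` commutes with the sourced `t–t'` torus Hamiltonian for label sets `S ⊆ ker χ_{B₁g}`.
[cite: Scalapino1995, §2] -/
theorem spaceGroupUnitary_mul_dWaveSourceTorusTT' {S : Finset (DihedralGroup 4)}
    (hS : ∀ γ ∈ S, b1gChar γ = 1) (tp U μ h : ℝ) (g : TorusSite 2 L × ↥S) :
    spaceGroupUnitary S g * dWaveSourceTorusTT' L tp U μ h =
      dWaveSourceTorusTT' L tp U μ h * spaceGroupUnitary S g :=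
  d4Affine_mul_dWaveSourceTorusTT' L _ (hS _ g.2.2) _ tp U μ h

/-- `(U_w D_γ)ᴴ` preserves the `S^z` eigenspaces (space-group maps commute with `S^z`).
[cite: Han2020Bootstrap, §3] -/
theorem spaceGroupUnitary_conjTranspose_mulVec_mem_fockSpinZSector (S : Finset (DihedralGroup 4))
    (g : TorusSite 2 L × ↥S) {M : ℝ} {ψ : Fock (Orb (FermionTorus 2 L))} (hψ : ψ ∈ fockSpinZSector M) :
    (spaceGroupUnitary S g)ᴴ *ᵥ ψ ∈ fockSpinZSector M := by
  show ((fockTranslate g.1).val * (fockD4 (L := L) (g.2 : DihedralGroup 4)).val)ᴴ *ᵥ ψ ∈ fockSpinZSector M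
  rw [conjTranspose_mul, fockD4_val_conjTranspose, fockTranslate_val_conjTranspose, ← mulVec_mulVec]
  exact fockRelabel_mapEquiv_mulVec_mem_fockSpinZSector _
    (fockRelabel_mapEquiv_mulVec_mem_fockSpinZSector _ hψ)

/-- **Certificate with an energy constraint ⇒ space-group-averaged expectation of a local observable in
EVERY `S^z`-eigenvector eigenstate of the pair-sourced `t–t'` torus.** Let
`A = dWaveSourceTorusTT' L tp U μ h`, `K = fockSpinZSector M`, `ψ ∈ K` a unit vector with `A ψ = E ψ`,
`S ⊆ D₄` a finite set of labels with `χ_{B₁g} = 1` containing `1` and closed under multiplication,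
`ω̄_ψ` the orbit state over `(U_w D_γ)_{w, γ ∈ S}`. Suppose the translates of a local energy `E_loc` sum
to `A`, those of observables `Dᵢ` to operators `Gᵢ = gᵢ` on `K`, and the torus algebra carries
`X − c·1 − Σᵢ μᵢ (Dᵢ − νᵢ·1) − κ (u·1 − E_loc) = Σ Λₐᵦ Oₐᴴ O_b + (Σₖ (A Xₖ − Xₖ A)
  + Σₗ (U_{wₗ} D_{γₗ} Yₗ (U_{wₗ} D_{γₗ})ᴴ − Yₗ) + Σᵣ (Zᵣ (Qᵣ − qᵣ) + (Qᵣ − qᵣ) Z'ᵣ) + Σⱼ (Cⱼ Wⱼ − Wⱼ Cⱼ))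
  + (Σₘ dₘ • (Vₘᴴ − Vₘ) + Σₖ aₖ • Mₖ)`
with `Λ ⪰ 0`, `γₗ ∈ S`, Hermitian `Qᵣ = qᵣ`, `Cⱼ = q'ⱼ` on `K` (reals; e.g. `Cⱼ = S^z` — the particle
number is NOT a charge of the sourced problem), real `dₘ`, contractions `Mₖ`. Then
`c − Σₖ ‖aₖ‖ + Σᵢ μᵢ (gᵢ/L² − νᵢ) + κ (u − E/L²) ≤ Re ω̄_ψ(X)`. Wang et al. 2024 §III with Han 2020 §3,
read in the symmetrised state of an arbitrary eigenvector (tree `re_orbitState_ge_of_local_certificate_ineq`).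
[cite: WangEtAl2024, §III] -/
theorem dWaveSourceTorusTT'_re_orbitState_ge_of_local_certificate_ineq (tp U μ h : ℝ) {M : ℝ}
    {S : Finset (DihedralGroup 4)} (h1 : (1 : DihedralGroup 4) ∈ S) (hmul : ∀ a ∈ S, ∀ b ∈ S, a * b ∈ S)
    (hS : ∀ γ ∈ S, b1gChar γ = 1)
    {ψ : Fock (Orb (FermionTorus 2 L))} (hψK : ψ ∈ fockSpinZSector M)
    (hψ1 : star ψ ⬝ᵥ ψ = 1) {E : ℝ} (hHψ : dWaveSourceTorusTT' L tp U μ h *ᵥ ψ = (E : ℂ) • ψ)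
    (X Eloc : Matrix (Finset (Orb (FermionTorus 2 L))) (Finset (Orb (FermionTorus 2 L))) ℂ)
    (hE : ∑ v : TorusSite 2 L, (fockTranslate v).val * Eloc * (fockTranslate v).valᴴ =
      dWaveSourceTorusTT' L tp U μ h) (κ u : ℝ)
    {δ' : Type*} (dens : Finset δ') (μc ν g : δ' → ℝ)
    (D G : δ' → Matrix (Finset (Orb (FermionTorus 2 L))) (Finset (Orb (FermionTorus 2 L))) ℂ)
    (hD : ∀ i ∈ dens, ∑ v : TorusSite 2 L, (fockTranslate v).val * D i * (fockTranslate v).valᴴ = G i)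
    (hG : ∀ i ∈ dens, ∀ φ ∈ fockSpinZSector (Λ := FermionTorus 2 L) M, G i *ᵥ φ = ((g i : ℝ) : ℂ) • φ)
    {m : Type*} [Fintype m] [DecidableEq m] {Λm : Matrix m m ℂ} (hΛ : Λm.PosSemidef)
    (O : m → Matrix (Finset (Orb (FermionTorus 2 L))) (Finset (Orb (FermionTorus 2 L))) ℂ)
    {κ' : Type*} (s : Finset κ')
    (Xc : κ' → Matrix (Finset (Orb (FermionTorus 2 L))) (Finset (Orb (FermionTorus 2 L))) ℂ)
    {ι : Type*} (tt : Finset ι) (γ : ι → DihedralGroup 4) (hγS : ∀ l ∈ tt, γ l ∈ S)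
    (wv : ι → TorusSite 2 L)
    (Y : ι → Matrix (Finset (Orb (FermionTorus 2 L))) (Finset (Orb (FermionTorus 2 L))) ℂ)
    {ρ : Type*} (r : Finset ρ)
    (Q Z Z' : ρ → Matrix (Finset (Orb (FermionTorus 2 L))) (Finset (Orb (FermionTorus 2 L))) ℂ)
    (q : ρ → ℝ) (hQh : ∀ i ∈ r, (Q i).IsHermitian)
    (hQ : ∀ i ∈ r, ∀ φ ∈ fockSpinZSector (Λ := FermionTorus 2 L) M, Q i *ᵥ φ = ((q i : ℝ) : ℂ) • φ)
    {γ' : Type*} (u' : Finset γ')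
    (C W : γ' → Matrix (Finset (Orb (FermionTorus 2 L))) (Finset (Orb (FermionTorus 2 L))) ℂ)
    (qc : γ' → ℝ) (hCh : ∀ j ∈ u', (C j).IsHermitian)
    (hC : ∀ j ∈ u', ∀ φ ∈ fockSpinZSector (Λ := FermionTorus 2 L) M, C j *ᵥ φ = ((qc j : ℝ) : ℂ) • φ)
    {δ : Type*} (ah : Finset δ) (dc : δ → ℝ)
    (V : δ → Matrix (Finset (Orb (FermionTorus 2 L))) (Finset (Orb (FermionTorus 2 L))) ℂ)
    {κ'' : Type*} (w : Finset κ'') (a : κ'' → ℂ)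
    (Mw : κ'' → Matrix (Finset (Orb (FermionTorus 2 L))) (Finset (Orb (FermionTorus 2 L))) ℂ)
    (hM : ∀ k ∈ w, (Mw k).IsContraction) {c : ℝ}
    (hcert : X - (c : ℂ) • (1 : Matrix (Finset (Orb (FermionTorus 2 L))) (Finset (Orb (FermionTorus 2 L))) ℂ) -
        ∑ i ∈ dens, ((μc i : ℝ) : ℂ) • (D i - ((ν i : ℝ) : ℂ) •
          (1 : Matrix (Finset (Orb (FermionTorus 2 L))) (Finset (Orb (FermionTorus 2 L))) ℂ)) -
        ((κ : ℝ) : ℂ) • (((u : ℝ) : ℂ) •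
          (1 : Matrix (Finset (Orb (FermionTorus 2 L))) (Finset (Orb (FermionTorus 2 L))) ℂ) - Eloc) =
      gramForm Λm O +
        (∑ k ∈ s, (dWaveSourceTorusTT' L tp U μ h * Xc k - Xc k * dWaveSourceTorusTT' L tp U μ h) +
          ∑ l ∈ tt, ((fockTranslate (wv l)).val * (fockD4 (L := L) (γ l)).val * Y l *
              ((fockTranslate (wv l)).val * (fockD4 (L := L) (γ l)).val)ᴴ - Y l) +
          ∑ i ∈ r, (Z i * (Q i - ((q i : ℝ) : ℂ) • 1) + (Q i - ((q i : ℝ) : ℂ) • 1) * Z' i) +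
          ∑ j ∈ u', (C j * W j - W j * C j)) +
        (∑ m' ∈ ah, ((dc m' : ℝ) : ℂ) • ((V m')ᴴ - V m') + ∑ k ∈ w, a k • Mw k)) :
    c - ∑ k ∈ w, ‖a k‖ + ∑ i ∈ dens, μc i * (g i / (L : ℝ) ^ 2 - ν i) + κ * (u - E / (L : ℝ) ^ 2) ≤
      (orbitState (spaceGroupUnitary S) ψ X).re := by
  haveI : Nonempty ↥S := ⟨⟨1, h1⟩⟩
  have hA : (dWaveSourceTorusTT' L tp U μ h).IsHermitian := dWaveSourceTorusTT'_isHermitian L tp U μ h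
  have h := re_orbitState_ge_of_local_certificate_ineq hA (fockSpinZSector M) hψK hψ1 hHψ
    (spaceGroupUnitary S) (fun g' => spaceGroupUnitary_mul_dWaveSourceTorusTT' hS tp U μ h g')
    (fun g' => d4Affine_conjTranspose_mul_self _ _)
    (fun g' φ hφ => spaceGroupUnitary_conjTranspose_mulVec_mem_fockSpinZSector S g' hφ)
    (fun v => (fockTranslate v).val) (fun v => spaceGroupUnitary_closed_translate h1 hmul v)
    X Eloc hE κ u dens μc ν g D G hD hG hΛ O s Xc tt
    (fun l => (fockTranslate (wv l)).val * (fockD4 (L := L) (γ l)).val) Y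
    (fun l hl => spaceGroupUnitary_closed hmul (wv l) (hγS l hl))
    r Q Z Z' q hQh hQ u' C W qc hCh hC ah dc V w a Mw hM hcert
  rw [card_torusSite] at h
  push_cast at h
  exact h

/-- **With the energy hypothesis**: `κ ≥ 0` and `E/L² ≤ u` give
`c − Σₖ ‖aₖ‖ + Σᵢ μᵢ (gᵢ/L² − νᵢ) ≤ Re ω̄_ψ(X)` for every such eigenvector of the pair-sourced torus —
the eigenvector is feasible for the energy constraint, Wang et al. 2024 §III. [cite: WangEtAl2024, §III] -/
theorem dWaveSourceTorusTT'_re_orbitState_ge_of_local_certificate_ineq_of_energy_le (tp U μ h : ℝ) {M : ℝ}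
    {S : Finset (DihedralGroup 4)} (h1 : (1 : DihedralGroup 4) ∈ S) (hmul : ∀ a ∈ S, ∀ b ∈ S, a * b ∈ S)
    (hS : ∀ γ ∈ S, b1gChar γ = 1)
    {ψ : Fock (Orb (FermionTorus 2 L))} (hψK : ψ ∈ fockSpinZSector M)
    (hψ1 : star ψ ⬝ᵥ ψ = 1) {E : ℝ} (hHψ : dWaveSourceTorusTT' L tp U μ h *ᵥ ψ = (E : ℂ) • ψ)
    (X Eloc : Matrix (Finset (Orb (FermionTorus 2 L))) (Finset (Orb (FermionTorus 2 L))) ℂ)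
    (hE : ∑ v : TorusSite 2 L, (fockTranslate v).val * Eloc * (fockTranslate v).valᴴ =
      dWaveSourceTorusTT' L tp U μ h) {κ u : ℝ} (hκ : 0 ≤ κ) (hEu : E / (L : ℝ) ^ 2 ≤ u)
    {δ' : Type*} (dens : Finset δ') (μc ν g : δ' → ℝ)
    (D G : δ' → Matrix (Finset (Orb (FermionTorus 2 L))) (Finset (Orb (FermionTorus 2 L))) ℂ)
    (hD : ∀ i ∈ dens, ∑ v : TorusSite 2 L, (fockTranslate v).val * D i * (fockTranslate v).valᴴ = G i)
    (hG : ∀ i ∈ dens, ∀ φ ∈ fockSpinZSector (Λ := FermionTorus 2 L) M, G i *ᵥ φ = ((g i : ℝ) : ℂ) • φ)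
    {m : Type*} [Fintype m] [DecidableEq m] {Λm : Matrix m m ℂ} (hΛ : Λm.PosSemidef)
    (O : m → Matrix (Finset (Orb (FermionTorus 2 L))) (Finset (Orb (FermionTorus 2 L))) ℂ)
    {κ' : Type*} (s : Finset κ')
    (Xc : κ' → Matrix (Finset (Orb (FermionTorus 2 L))) (Finset (Orb (FermionTorus 2 L))) ℂ)
    {ι : Type*} (tt : Finset ι) (γ : ι → DihedralGroup 4) (hγS : ∀ l ∈ tt, γ l ∈ S)
    (wv : ι → TorusSite 2 L)
    (Y : ι → Matrix (Finset (Orb (FermionTorus 2 L))) (Finset (Orb (FermionTorus 2 L))) ℂ)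
    {ρ : Type*} (r : Finset ρ)
    (Q Z Z' : ρ → Matrix (Finset (Orb (FermionTorus 2 L))) (Finset (Orb (FermionTorus 2 L))) ℂ)
    (q : ρ → ℝ) (hQh : ∀ i ∈ r, (Q i).IsHermitian)
    (hQ : ∀ i ∈ r, ∀ φ ∈ fockSpinZSector (Λ := FermionTorus 2 L) M, Q i *ᵥ φ = ((q i : ℝ) : ℂ) • φ)
    {γ' : Type*} (u' : Finset γ')
    (C W : γ' → Matrix (Finset (Orb (FermionTorus 2 L))) (Finset (Orb (FermionTorus 2 L))) ℂ)
    (qc : γ' → ℝ) (hCh : ∀ j ∈ u', (C j).IsHermitian)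
    (hC : ∀ j ∈ u', ∀ φ ∈ fockSpinZSector (Λ := FermionTorus 2 L) M, C j *ᵥ φ = ((qc j : ℝ) : ℂ) • φ)
    {δ : Type*} (ah : Finset δ) (dc : δ → ℝ)
    (V : δ → Matrix (Finset (Orb (FermionTorus 2 L))) (Finset (Orb (FermionTorus 2 L))) ℂ)
    {κ'' : Type*} (w : Finset κ'') (a : κ'' → ℂ)
    (Mw : κ'' → Matrix (Finset (Orb (FermionTorus 2 L))) (Finset (Orb (FermionTorus 2 L))) ℂ)
    (hM : ∀ k ∈ w, (Mw k).IsContraction) {c : ℝ}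
    (hcert : X - (c : ℂ) • (1 : Matrix (Finset (Orb (FermionTorus 2 L))) (Finset (Orb (FermionTorus 2 L))) ℂ) -
        ∑ i ∈ dens, ((μc i : ℝ) : ℂ) • (D i - ((ν i : ℝ) : ℂ) •
          (1 : Matrix (Finset (Orb (FermionTorus 2 L))) (Finset (Orb (FermionTorus 2 L))) ℂ)) -
        ((κ : ℝ) : ℂ) • (((u : ℝ) : ℂ) •
          (1 : Matrix (Finset (Orb (FermionTorus 2 L))) (Finset (Orb (FermionTorus 2 L))) ℂ) - Eloc) =
      gramForm Λm O +
        (∑ k ∈ s, (dWaveSourceTorusTT' L tp U μ h * Xc k - Xc k * dWaveSourceTorusTT' L tp U μ h) +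
          ∑ l ∈ tt, ((fockTranslate (wv l)).val * (fockD4 (L := L) (γ l)).val * Y l *
              ((fockTranslate (wv l)).val * (fockD4 (L := L) (γ l)).val)ᴴ - Y l) +
          ∑ i ∈ r, (Z i * (Q i - ((q i : ℝ) : ℂ) • 1) + (Q i - ((q i : ℝ) : ℂ) • 1) * Z' i) +
          ∑ j ∈ u', (C j * W j - W j * C j)) +
        (∑ m' ∈ ah, ((dc m' : ℝ) : ℂ) • ((V m')ᴴ - V m') + ∑ k ∈ w, a k • Mw k)) :
    c - ∑ k ∈ w, ‖a k‖ + ∑ i ∈ dens, μc i * (g i / (L : ℝ) ^ 2 - ν i) ≤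
      (orbitState (spaceGroupUnitary S) ψ X).re := by
  have h := dWaveSourceTorusTT'_re_orbitState_ge_of_local_certificate_ineq tp U μ h h1 hmul hS hψK hψ1
    hHψ X Eloc hE κ u dens μc ν g D G hD hG hΛ O s Xc tt γ hγS wv Y r Q Z Z' q hQh hQ u' C W qc hCh hC
    ah dc V w a Mw hM hcert
  have hslack : 0 ≤ κ * (u - E / (L : ℝ) ^ 2) := mul_nonneg hκ (sub_nonneg.2 hEu)
  linarith

omit [NeZero L] in
/-- **`S^z` is an admissible charge of the sourced problem**: it is Hermitian and acts as the real
scalar `M` on `fockSpinZSector M`, so `S^z`-charged words `W` enter certificates through the null terms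
`S^z W − W S^z`. (The particle number does NOT act as a scalar on this sector.) [cite: Han2020Bootstrap, §3] -/
theorem spinZ_isHermitian_and_mulVec_fockSpinZSector (M : ℝ) :
    (HubbardWave0.spinZ : Matrix (Finset (Orb (FermionTorus 2 L))) _ ℂ).IsHermitian ∧
      ∀ φ ∈ fockSpinZSector (Λ := FermionTorus 2 L) M, HubbardWave0.spinZ *ᵥ φ = ((M : ℝ) : ℂ) • φ :=
  ⟨HubbardWave0.spinZ_isHermitian, fun _ hφ => spinZ_mulVec_of_mem_fockSpinZSector hφ⟩

end Certificate

end Literature.MathematicalPhysics.QuantumLattice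

end
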